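import Literature.Topology.FourManifolds.OneOneSimpleCusp
import Literature.Topology.FourManifolds.IntrinsicFoldCriterion
import Literature.Analysis.Calculus.CurveCompThirdDeriv
import HarnessLib

/-!
# The invariant cubic of a cusp candidate: curve formula and invariance

Topic `Literature/Topology/FourManifolds` (programme of the fact
`Literature.Topology.FourManifolds.exists_isSimplifiedBrokenLefschetzFibration`, Baykur–Saeki 2017, §2.1:
generic maps `X⁴ → Σ²` have folds and cusps only).  `OneOneSimpleCusp.lean` extracted from the
second-order genericity theorem the non-vanishing of the cubic
`c₃ = ℓ(D³g(x)(k,k,k)) + 3τ μ(D²g(x)(k,k))` at a cusp candidate (`x` critical of rank one with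
cokernel covector `ℓ`, `k` a radical vector of the kernel Hessian, `μ` a complementary covector,
`τ` the multiplier with `ℓ D²g(x)(·, k) = -τ μ dg_x`).  This file makes the cubic usable in
other coordinates — it is the simple-cusp quantity `∂³h/∂x³` of Whitney / Golubitsky–Guillemin
(*Stable Mappings and Their Singularities* (1973), Ch. VI §2, Def. 2.3, p. 147) only after the
rank-one and splitting changes of coordinates:

* `OneJet.cubicForm g x ℓ μ k τ` — the cubic for a map between arbitrary real normed spaces
  (`OneJet.cuspCubic_eq_cubicForm`: the chart version of `OneOneSimpleCusp.lean` is the case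
  `ℓ = ℓ_A + c ℓ_B`, `μ = ℓ_B`, `k = radVec a y`);
* `OneJet.cubicForm_eq_curve` — **curve formula**: for ANY `C^∞` curve `γ` with `γ(0) = x`,
  `γ'(0) = k`: `c₃ = (ℓ ∘ g ∘ γ)'''(0) + 3τ (μ ∘ g ∘ γ)''(0)` (Faà di Bruno to order three,
  `Literature.Analysis.Calculus.deriv_deriv_deriv_comp_curve_symm`: the terms in `γ''(0)` cancel
  by the multiplier relation, the term in `γ'''(0)` dies on `ℓ ∘ dg_x = 0`);
* `OneJet.cubicForm_comp_source` — **invariance under reparametrisation of the source**: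
  `c₃(g ∘ σ; x', k') = c₃(g; σ x', Dσ(x') k')` for every `C^∞` map `σ` (the curve
  `s ↦ σ(x' + s k')`);
* `OneJet.cubicForm_comp_target` — **invariance under diffeomorphisms of the target**:
  `c₃(ψ ∘ g; ℓ, μ) = c₃(g; ℓ ∘ Dψ, μ ∘ Dψ)` (`(ψ ∘ c)''' = Dψ(c''')` and `(ψ ∘ c)'' = Dψ(c'')`
  for a curve `c = g ∘ γ` with `c'(0) = dg_x k = 0`).

Everything is proved; `cubicForm` is the only definition; no named fact (D-0026).

## References

* M. Golubitsky, V. Guillemin, *Stable Mappings and Their Singularities*, GTM 14 (1973), Ch. VI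
  §2, Def. 2.3 and p. 147 (the simple-cusp quantity), §4 (`S_{1,1}`). [GolubitskyGuillemin1973]
* R. İ. Baykur, O. Saeki, *Simplifying indefinite fibrations on 4-manifolds*, arXiv:1705.11169,
  §2.1, p. 6. [BaykurSaeki2017]
-/

noncomputable section

set_option maxSynthPendingDepth 2

open Set Function Filter
open scoped ContDiff Topology

namespace Literature.Topology.FourManifolds

namespace OneJet

open Literature.Analysis.Calculus

section General

variable {E E' F F' : Type*} [NormedAddCommGroup E] [NormedSpace ℝ E] [NormedAddCommGroup E']
  [NormedSpace ℝ E'] [NormedAddCommGroup F] [NormedSpace ℝ F] [NormedAddCommGroup F']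
  [NormedSpace ℝ F']

/-! ### Linear post-composition and one-variable derivatives -/

/-- `(ℓ ∘ c)' = ℓ ∘ c'` on an open set of differentiability. [folklore] -/
theorem deriv_clm_apply_eqOn {c : ℝ → F} {I : Set ℝ} (hI : IsOpen I) (hc : DifferentiableOn ℝ c I)
    (ℓ : F →L[ℝ] F') : EqOn (deriv fun s => ℓ (c s)) (fun s => ℓ (deriv c s)) I := fun s hs =>
  (ℓ.hasFDerivAt.comp_hasDerivAt s (hc.differentiableAt (hI.mem_nhds hs)).hasDerivAt).deriv

/-- `(ℓ ∘ c)'' = ℓ ∘ c''` for `c ∈ C²` on an open set. [folklore] -/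
theorem deriv_deriv_clm_apply {c : ℝ → F} {I : Set ℝ} (hI : IsOpen I) (hc : ContDiffOn ℝ 2 c I)
    (ℓ : F →L[ℝ] F') {s : ℝ} (hs : s ∈ I) :
    deriv (deriv fun s => ℓ (c s)) s = ℓ (deriv (deriv c) s) := by
  have h1 : deriv (fun s => ℓ (c s)) =ᶠ[𝓝 s] fun s => ℓ (deriv c s) :=
    eventuallyEq_of_mem (hI.mem_nhds hs)
      (deriv_clm_apply_eqOn hI (hc.differentiableOn two_ne_zero) ℓ)
  rw [h1.deriv_eq]
  have hc' : ContDiffOn ℝ 1 (deriv c) I := hc.deriv_of_isOpen hI (by norm_num)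
  exact deriv_clm_apply_eqOn hI (hc'.differentiableOn one_ne_zero) ℓ hs

/-- `(ℓ ∘ c)''' = ℓ ∘ c'''` for `c ∈ C³` on an open set. [folklore] -/
theorem deriv_deriv_deriv_clm_apply {c : ℝ → F} {I : Set ℝ} (hI : IsOpen I)
    (hc : ContDiffOn ℝ 3 c I) (ℓ : F →L[ℝ] F') {s : ℝ} (hs : s ∈ I) :
    deriv (deriv (deriv fun s => ℓ (c s))) s = ℓ (deriv (deriv (deriv c)) s) := by
  have h1 : deriv (fun s => ℓ (c s)) =ᶠ[𝓝 s] fun s => ℓ (deriv c s) :=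
    eventuallyEq_of_mem (hI.mem_nhds hs)
      (deriv_clm_apply_eqOn hI (hc.differentiableOn three_ne_zero) ℓ)
  have h2 : deriv (deriv fun s => ℓ (c s)) =ᶠ[𝓝 s] deriv (fun s => ℓ (deriv c s)) := by
    have hI' : ∀ᶠ s' in 𝓝 s, s' ∈ I := hI.mem_nhds hs
    filter_upwards [hI'] with s' hs'
    have h1' : deriv (fun s => ℓ (c s)) =ᶠ[𝓝 s'] fun s => ℓ (deriv c s) :=
      eventuallyEq_of_mem (hI.mem_nhds hs')
        (deriv_clm_apply_eqOn hI (hc.differentiableOn three_ne_zero) ℓ)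
    exact h1'.deriv_eq
  rw [h2.deriv_eq]
  have hc' : ContDiffOn ℝ 2 (deriv c) I := hc.deriv_of_isOpen hI (by norm_num)
  exact deriv_deriv_clm_apply hI hc' ℓ hs

/-! ### The cubic of a cusp candidate -/

/-- **The cubic of a cusp candidate** of `g : E → F` at `x`, for a cokernel covector `ℓ`, a
complementary covector `μ`, a radical direction `k` and the multiplier `τ`:
`c₃ = ℓ(D³g(x)(k, k, k)) + 3τ μ(D²g(x)(k, k))`. [cite: GolubitskyGuillemin1973, Ch. VI §2, Def. 2.3] -/
def cubicForm (g : E → F) (x : E) (ℓ μ : F →L[ℝ] ℝ) (k : E) (τ : ℝ) : ℝ :=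
  ℓ (fderiv ℝ (fderiv ℝ (fderiv ℝ g)) x k k k) + 3 * τ * μ (fderiv ℝ (fderiv ℝ g) x k k)

/-- Unfolding `cubicForm`. [folklore] -/
theorem cubicForm_def (g : E → F) (x : E) (ℓ μ : F →L[ℝ] ℝ) (k : E) (τ : ℝ) :
    cubicForm g x ℓ μ k τ =
      ℓ (fderiv ℝ (fderiv ℝ (fderiv ℝ g)) x k k k) + 3 * τ * μ (fderiv ℝ (fderiv ℝ g) x k k) :=
  rfl

/-- `2 ≤ ∞` in `WithTop ℕ∞`. [folklore] -/
private theorem two_le_infty' : (2 : WithTop ℕ∞) ≤ ∞ := WithTop.coe_le_coe.2 le_top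

/-- `3 ≤ ∞` in `WithTop ℕ∞`. [folklore] -/
private theorem three_le_infty' : (3 : WithTop ℕ∞) ≤ ∞ := WithTop.coe_le_coe.2 le_top

/-- **Curve formula for the cubic.**  Let `g` be `C^∞` on the open `Ω`, `γ` a `C^∞` curve on the
open `I ∋ 0` with `γ(I) ⊆ Ω`, `γ(0) = x`, `γ'(0) = k`, and let `ℓ ∘ dg_x = 0` and
`ℓ(D²g(x)(v, k)) = -τ μ(dg_x v)` for all `v` (the zero conditions of the incidence system).
Then `c₃ = (ℓ ∘ g ∘ γ)'''(0) + 3τ (μ ∘ g ∘ γ)''(0)`. [folklore] -/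
theorem cubicForm_eq_curve {g : E → F} {Ω : Set E} (hΩ : IsOpen Ω) (hg : ContDiffOn ℝ ∞ g Ω)
    {γ : ℝ → E} {I : Set ℝ} (hI : IsOpen I) (h0I : (0 : ℝ) ∈ I) (hγ : ContDiffOn ℝ ∞ γ I)
    (hmaps : MapsTo γ I Ω) {x : E} (hγ0 : γ 0 = x) {k : E} (hγ1 : deriv γ 0 = k)
    {ℓ μ : F →L[ℝ] ℝ} {τ : ℝ} (hZ1 : ℓ.comp (fderiv ℝ g x) = 0)
    (hZ2 : ∀ v, ℓ (fderiv ℝ (fderiv ℝ g) x v k) = -(τ * μ (fderiv ℝ g x v))) :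
    cubicForm g x ℓ μ k τ =
      deriv (deriv (deriv fun s => ℓ (g (γ s)))) 0 + 3 * τ * deriv (deriv fun s => μ (g (γ s))) 0 := by
  have hc : ContDiffOn ℝ ∞ (g ∘ γ) I := hg.comp hγ hmaps
  have hsymm : ∀ v w, fderiv ℝ (fderiv ℝ g) (γ 0) v w = fderiv ℝ (fderiv ℝ g) (γ 0) w v :=
    fun v w => ((hg.contDiffAt (hΩ.mem_nhds (hmaps h0I))).isSymmSndFDerivAt
      (by simp only [minSmoothness_of_isRCLikeNormedField]; exact two_le_infty')) v w
  have h3 := deriv_deriv_deriv_comp_curve_symm hI hΩ three_le_infty' hg hγ hmaps h0I hsymm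
  have h2 := deriv_deriv_comp_curve hI hΩ two_le_infty' hg hγ hmaps h0I
  dsimp only at h2
  have hℓ3 : deriv (deriv (deriv fun s => ℓ (g (γ s)))) 0 = ℓ (deriv (deriv (deriv (g ∘ γ))) 0) :=
    deriv_deriv_deriv_clm_apply hI (hc.of_le three_le_infty') ℓ h0I
  have hμ2 : deriv (deriv fun s => μ (g (γ s))) 0 = μ (deriv (deriv (g ∘ γ)) 0) :=
    deriv_deriv_clm_apply hI (hc.of_le two_le_infty') μ h0I
  rw [hℓ3, hμ2, h3, h2, hγ0, hγ1, cubicForm_def]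
  have hZ1v : ∀ v, ℓ (fderiv ℝ g x v) = 0 := fun v => by
    have := congrArg (fun φ : E →L[ℝ] ℝ => φ v) hZ1
    simpa using this
  simp only [map_add, map_smul, smul_eq_mul, hZ2, hZ1v]
  ring

/-- **Invariance of the cubic under reparametrisation of the source.**  For a `C^∞` map `σ`
(`σ(Ω') ⊆ Ω`, derivative `A` at `x'`) and data satisfying the zero conditions at `σ x'` with
direction `A k'`: `c₃(g ∘ σ; x', k') = c₃(g; σ x', A k')` — both are the curve expression for the
curve `s ↦ σ(x' + s k')`; no invertibility of `A` is needed. [folklore] -/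
theorem cubicForm_comp_source {g : E → F} {Ω : Set E} (hΩ : IsOpen Ω) (hg : ContDiffOn ℝ ∞ g Ω)
    {σ : E' → E} {Ω' : Set E'} (hΩ' : IsOpen Ω') (hσ : ContDiffOn ℝ ∞ σ Ω')
    (hσΩ : MapsTo σ Ω' Ω) {x' : E'} (hx' : x' ∈ Ω') {A : E' →L[ℝ] E} (hσd : HasFDerivAt σ A x')
    {ℓ μ : F →L[ℝ] ℝ} {k' : E'} {τ : ℝ} (hZ1 : ℓ.comp (fderiv ℝ g (σ x')) = 0)
    (hZ2 : ∀ v, ℓ (fderiv ℝ (fderiv ℝ g) (σ x') v (A k')) = -(τ * μ (fderiv ℝ g (σ x') v))) :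
    cubicForm (g ∘ σ) x' ℓ μ k' τ = cubicForm g (σ x') ℓ μ (A k') τ := by
  -- the line through `x'` and the curve `γ = σ ∘ line`
  set I : Set ℝ := (fun s : ℝ => x' + s • k') ⁻¹' Ω' with hI
  have hlc : ContDiff ℝ ∞ fun s : ℝ => x' + s • k' :=
    contDiff_const.add (contDiff_id.smul contDiff_const)
  have hIo : IsOpen I := hΩ'.preimage hlc.continuous
  have h0I : (0 : ℝ) ∈ I := by simp [hI, hx']
  have hline : HasDerivAt (fun s : ℝ => x' + s • k') k' 0 := by
    simpa using ((hasDerivAt_id (0 : ℝ)).smul_const k').const_add x'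
  have hγs : ContDiffOn ℝ ∞ (fun s : ℝ => σ (x' + s • k')) I :=
    hσ.comp hlc.contDiffOn fun s hs => hs
  have hγmaps : MapsTo (fun s : ℝ => σ (x' + s • k')) I Ω := fun s hs => hσΩ hs
  have hγ0 : (fun s : ℝ => σ (x' + s • k')) 0 = σ x' := by simp
  have hγ1 : deriv (fun s : ℝ => σ (x' + s • k')) 0 = A k' :=
    (hσd.comp_hasDerivAt_of_eq 0 hline (by simp)).deriv
  -- the right-hand side through the curve
  have hR := cubicForm_eq_curve hΩ hg hIo h0I hγs hγmaps hγ0 hγ1 hZ1 hZ2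
  -- the left-hand side: zero conditions for `g ∘ σ` at `x'` with direction `k'`
  have hgσ : ContDiffOn ℝ ∞ (g ∘ σ) Ω' := hg.comp hσ hσΩ
  have hσx : fderiv ℝ σ x' = A := hσd.fderiv
  have hgd : DifferentiableAt ℝ g (σ x') :=
    (hg.contDiffAt (hΩ.mem_nhds (hσΩ hx'))).differentiableAt (by simp)
  have hfd : fderiv ℝ (g ∘ σ) x' = (fderiv ℝ g (σ x')).comp A := by
    rw [fderiv_comp x' hgd hσd.differentiableAt, hσx]
  have hZ1' : ℓ.comp (fderiv ℝ (g ∘ σ) x') = 0 := by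
    rw [hfd, ← ContinuousLinearMap.comp_assoc, hZ1, ContinuousLinearMap.zero_comp]
  have hZ1v : ∀ w, ℓ (fderiv ℝ g (σ x') w) = 0 := fun w => by
    have := congrArg (fun φ : E →L[ℝ] ℝ => φ w) hZ1
    simpa using this
  have hZ2' : ∀ v, ℓ (fderiv ℝ (fderiv ℝ (g ∘ σ)) x' v k') =
      -(τ * μ (fderiv ℝ (g ∘ σ) x' v)) := fun v => by
    have hg2 : ContDiffAt ℝ 2 g (σ x') :=
      ((hg.contDiffAt (hΩ.mem_nhds (hσΩ hx'))).of_le two_le_infty')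
    have hσ2 : ContDiffAt ℝ 2 σ x' := ((hσ.contDiffAt (hΩ'.mem_nhds hx')).of_le two_le_infty')
    rw [fderiv_fderiv_comp_apply_eq_add hg2 hσ2 v k', hσx, map_add, hZ1v, zero_add, hZ2, hfd]
    rfl
  have hL := cubicForm_eq_curve (g := g ∘ σ) hΩ' hgσ hIo h0I hlc.contDiffOn (fun s hs => hs)
    (by simp) hline.deriv hZ1' hZ2'
  rw [hL, hR]
  rfl

/-- **Invariance of the cubic under diffeomorphisms of the target.**  For a `C^∞` map `ψ` on an
open `V ⊇ g(Ω)` with derivative `B` at `g x`, a kernel direction `k` (`dg_x k = 0`) and data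
`(ℓ ∘ B, μ ∘ B, τ)` satisfying the zero conditions for `g`:
`c₃(ψ ∘ g; ℓ, μ) = c₃(g; ℓ ∘ B, μ ∘ B)`. [folklore] -/
theorem cubicForm_comp_target {g : E → F} {Ω : Set E} (hΩ : IsOpen Ω) (hg : ContDiffOn ℝ ∞ g Ω)
    {x : E} (hx : x ∈ Ω) {ψ : F → F'} {V : Set F} (hV : IsOpen V) (hψ : ContDiffOn ℝ ∞ ψ V)
    (hgV : MapsTo g Ω V) {B : F →L[ℝ] F'} (hψd : HasFDerivAt ψ B (g x)) {ℓ μ : F' →L[ℝ] ℝ}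
    {k : E} {τ : ℝ} (hk : fderiv ℝ g x k = 0) (hZ1 : (ℓ.comp B).comp (fderiv ℝ g x) = 0)
    (hZ2 : ∀ v, (ℓ.comp B) (fderiv ℝ (fderiv ℝ g) x v k) = -(τ * (μ.comp B) (fderiv ℝ g x v))) :
    cubicForm (ψ ∘ g) x ℓ μ k τ = cubicForm g x (ℓ.comp B) (μ.comp B) k τ := by
  -- the line through `x` and the curve `c = g ∘ line`
  set I : Set ℝ := (fun s : ℝ => x + s • k) ⁻¹' Ω with hI
  have hlc : ContDiff ℝ ∞ fun s : ℝ => x + s • k :=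
    contDiff_const.add (contDiff_id.smul contDiff_const)
  have hIo : IsOpen I := hΩ.preimage hlc.continuous
  have h0I : (0 : ℝ) ∈ I := by simp [hI, hx]
  have hline : HasDerivAt (fun s : ℝ => x + s • k) k 0 := by
    simpa using ((hasDerivAt_id (0 : ℝ)).smul_const k).const_add x
  have hmapsI : MapsTo (fun s : ℝ => x + s • k) I Ω := fun s hs => hs
  -- right-hand side
  have hR := cubicForm_eq_curve hΩ hg hIo h0I hlc.contDiffOn hmapsI (by simp) hline.deriv hZ1 hZ2
  -- left-hand side: zero conditions for `ψ ∘ g`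
  have hψg : ContDiffOn ℝ ∞ (ψ ∘ g) Ω := hψ.comp hg hgV
  have hgd : DifferentiableAt ℝ g x := (hg.contDiffAt (hΩ.mem_nhds hx)).differentiableAt (by simp)
  have hfd : fderiv ℝ (ψ ∘ g) x = B.comp (fderiv ℝ g x) := by
    rw [fderiv_comp x hψd.differentiableAt hgd, hψd.fderiv]
  have hZ1' : ℓ.comp (fderiv ℝ (ψ ∘ g) x) = 0 := by
    rw [hfd, ← ContinuousLinearMap.comp_assoc, hZ1]
  have hZ2' : ∀ v, ℓ (fderiv ℝ (fderiv ℝ (ψ ∘ g)) x v k) = -(τ * μ (fderiv ℝ (ψ ∘ g) x v)) := by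
    intro v
    have hψ2 : ContDiffAt ℝ 2 ψ (g x) := (hψ.contDiffAt (hV.mem_nhds (hgV hx))).of_le two_le_infty'
    have hg2 : ContDiffAt ℝ 2 g x := (hg.contDiffAt (hΩ.mem_nhds hx)).of_le two_le_infty'
    rw [fderiv_fderiv_comp_apply_eq_add hψ2 hg2 v k, hψd.fderiv, hk, map_zero, add_zero, hfd]
    exact hZ2 v
  have hL := cubicForm_eq_curve (g := ψ ∘ g) hΩ hψg hIo h0I hlc.contDiffOn hmapsI (by simp)
    hline.deriv hZ1' hZ2'
  -- derivatives of `ψ ∘ c` for the curve `c = g ∘ line` with `c'(0) = 0`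
  set c : ℝ → F := fun s => g (x + s • k) with hc
  have hcs : ContDiffOn ℝ ∞ c I := hg.comp hlc.contDiffOn hmapsI
  have hcV : MapsTo c I V := fun s hs => hgV (hmapsI hs)
  have hc1 : deriv c 0 = 0 := by
    have h := deriv_comp_curve hIo hΩ (n := ∞) (by simp) hg hlc.contDiffOn hmapsI h0I
    dsimp only at h
    rw [show c = g ∘ fun s : ℝ => x + s • k from rfl, h]
    simp [hline.deriv, hk]
  have hψc3 : deriv (deriv (deriv (ψ ∘ c))) 0 = B (deriv (deriv (deriv c)) 0) := by
    have h := deriv_deriv_deriv_comp_curve hIo hV three_le_infty' hψ hcs hcV h0I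
    dsimp only at h
    rw [h, hc1]
    simp [hc, hψd.fderiv]
  have hψc2 : deriv (deriv (ψ ∘ c)) 0 = B (deriv (deriv c) 0) := by
    have h := deriv_deriv_comp_curve hIo hV two_le_infty' hψ hcs hcV h0I
    dsimp only at h
    rw [h, hc1]
    simp [hc, hψd.fderiv]
  -- post-composition by the covectors
  have hψcs : ContDiffOn ℝ ∞ (ψ ∘ c) I := hψ.comp hcs hcV
  have e1 : deriv (deriv (deriv fun s : ℝ => ℓ ((ψ ∘ g) (x + s • k)))) 0 =
      ℓ (deriv (deriv (deriv (ψ ∘ c))) 0) :=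
    deriv_deriv_deriv_clm_apply hIo (hψcs.of_le three_le_infty') ℓ h0I
  have e2 : deriv (deriv fun s : ℝ => μ ((ψ ∘ g) (x + s • k))) 0 = μ (deriv (deriv (ψ ∘ c)) 0) :=
    deriv_deriv_clm_apply hIo (hψcs.of_le two_le_infty') μ h0I
  have e3 : deriv (deriv (deriv fun s : ℝ => (ℓ.comp B) (g (x + s • k)))) 0 =
      (ℓ.comp B) (deriv (deriv (deriv c)) 0) :=
    deriv_deriv_deriv_clm_apply hIo (hcs.of_le three_le_infty') (ℓ.comp B) h0I
  have e4 : deriv (deriv fun s : ℝ => (μ.comp B) (g (x + s • k))) 0 =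
      (μ.comp B) (deriv (deriv c) 0) :=
    deriv_deriv_clm_apply hIo (hcs.of_le two_le_infty') (μ.comp B) h0I
  rw [hL, hR, e1, e2, e3, e4, hψc3, hψc2]
  rfl

end General

section Four

/-- Local notation for this file: the model space `ℝⁿ = EuclideanSpace ℝ (Fin n)`. -/
local notation "𝔼 " n:arg => EuclideanSpace ℝ (Fin n)

/-- The chart cubic of `OneOneSimpleCusp.lean` is the cubic form of the chart data. [folklore] -/
theorem cuspCubic_eq_cubicForm (ℓA ℓB : (𝔼 2) →L[ℝ] ℝ) (a : Fin 4) (g : 𝔼 4 → 𝔼 2) (x : 𝔼 4)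
    (c : ℝ) (y : 𝔼 3) (τ : ℝ) :
    cuspCubic ℓA ℓB a g (x, (c, (y, τ))) = cubicForm g x (ℓA + c • ℓB) ℓB (radVec a y) τ :=
  rfl

end Four

end OneJet

end Literature.Topology.FourManifolds
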